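import Summits.AtomisticToContinuum.FouriersLaw.Theorems.HonestZwanzigPositiveMemoryGreenKuboFloor

/-!
# HonestZwanzig / PositiveMemory — the floor from NOT-INSULATING and the bulk backflow floor (line `Sketch`, Stub PB)

Support file for item `stmt-AtomisticToContinuum-12694` (`PositiveMemory` of route `HonestZwanzig`, sub-problem
`FouriersLaw`), line `Sketch` v8, registered stub `stub_positiveMemory_of_backflowFloor`:
`(Kirchhoff flatness) → JunctionLocality.ConductanceLowerBound → (bulk backflow floor) → PositiveMemory`.

`ConductanceLowerBound` (item stmt-AtomisticToContinuum-11749) gives `c > 0`, `N₁` with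
`∫₀^∞corr_N(J,J) ≥ c(N−1)T²` for `N ≥ N₁` (`stub_greenKuboFloor`, landed); by Kirchhoff flatness the unprojected limit on
every genuine bond is `ℓ = ∫₀^∞corr(J,J)/(N−1) ≥ cT²`; the backflow floor at `δ = cT²/2` gives `R₀`, and with
`R = max R₀ N₁` every `R`-bulk limit `ρ = lim schur_s(j_b,J)` is `≥ ℓ − cT²/2 ≥ cT²/2 =: k₀`.
No definitions, no named facts.
-/

noncomputable section

open MeasureTheory Finset Real Set Filter Topology
open Literature.MathematicalPhysics.KineticTheory.HeatConduction

namespace Summit.AtomisticToContinuum.FouriersLaw.Theorems.HonestZwanzig.PositiveMemory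

/-- **Stub PB — the floor from NOT-INSULATING and the bulk backflow floor** (registered v8; lead; bookkeeping,
provable now): `ConductanceLowerBound` gives `c > 0`, `N₁` with `∫₀^∞corr_N(J,J) ≥ c(N−1)T²` for `N ≥ N₁`
(`stub_greenKuboFloor`, landed), so by Kirchhoff flatness the unprojected limit on every genuine bond is `ℓ ≥ cT²`; the
backflow floor at `δ = cT²/2` gives `R₀`, and with `R = max R₀ N₁` every `R`-bulk limit is `≥ cT²/2`. -/
theorem stub_positiveMemory_of_backflowFloor :
    (∀ ω₂ lam β γ : ℝ, 0 < ω₂ → 0 < lam → 0 < β → 0 < γ → ∀ T : ℝ, 0 < T → ∀ N : ℕ, 2 ≤ N →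
    let P := Literature.MathematicalPhysics.KineticTheory.HeatConduction.pinnedChain ω₂ lam β γ;
    let X := Literature.MathematicalPhysics.KineticTheory.HeatConduction.PhaseSpace N;
    let μ : MeasureTheory.Measure X := P.gibbsMeasure N T;
    let corr : (X → ℝ) → (X → ℝ) → ℝ → ℝ := fun f g t =>
      (∫ z, f z * (∫ y, g y ∂(P.transitionKernel N T T t.toNNReal z)) ∂μ) - (∫ z, f z ∂μ) * (∫ z, g z ∂μ);
    let lap : ℝ → (X → ℝ) → (X → ℝ) → ℝ := fun s f g =>
      ∫ t in Set.Ioi (0 : ℝ), Real.exp (-(s * t)) * corr f g t;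
    let J : X → ℝ := fun z => ∑ i : Fin N, P.bondCurrent N i z;
    ∀ b : Fin N, b.val + 1 < N →
      Filter.Tendsto (fun s => lap s (P.bondCurrent N b) J) (nhdsWithin (0 : ℝ) (Set.Ioi 0))
        (nhds ((∫ t in Set.Ioi (0 : ℝ), corr J J t) / ((N : ℝ) - 1)))) →
    Summit.AtomisticToContinuum.FouriersLaw.Theses.JunctionLocality.ConductanceLowerBound →
    (∀ ω₂ lam β γ : ℝ, 0 < ω₂ → 0 < lam → 0 < β → 0 < γ → ∀ T : ℝ, 0 < T → ∀ δ : ℝ, 0 < δ → ∃ R : ℕ, ∀ N : ℕ, 2 ≤ N →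
    let P := Literature.MathematicalPhysics.KineticTheory.HeatConduction.pinnedChain ω₂ lam β γ;
    let X := Literature.MathematicalPhysics.KineticTheory.HeatConduction.PhaseSpace N;
    let μ : MeasureTheory.Measure X := P.gibbsMeasure N T;
    let corr : (X → ℝ) → (X → ℝ) → ℝ → ℝ := fun f g t =>
      (∫ z, f z * (∫ y, g y ∂(P.transitionKernel N T T t.toNNReal z)) ∂μ) - (∫ z, f z ∂μ) * (∫ z, g z ∂μ);
    let lap : ℝ → (X → ℝ) → (X → ℝ) → ℝ := fun s f g =>
      ∫ t in Set.Ioi (0 : ℝ), Real.exp (-(s * t)) * corr f g t;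
    let e : Fin N → X → ℝ := fun x z => z.2 x ^ 2 / 2 + P.U (z.1 x) +
      ∑ j : Fin N, ((if j.val = x.val + 1 then P.V (z.1 j - z.1 x) / 2 else 0) +
        (if x.val = j.val + 1 then P.V (z.1 x - z.1 j) / 2 else 0));
    let G : ℝ → Matrix (Fin N) (Fin N) ℝ := fun s => Matrix.of fun x y => lap s (e x) (e y);
    let schur : ℝ → (X → ℝ) → (X → ℝ) → ℝ := fun s f g =>
      lap s f g - ∑ x : Fin N, ∑ y : Fin N, lap s f (e x) * (G s)⁻¹ x y * lap s (e y) g;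
    let J : X → ℝ := fun z => ∑ i : Fin N, P.bondCurrent N i z;
    ∀ b : Fin N, R ≤ b.val → b.val + 2 + R ≤ N → ∀ ρ ℓ : ℝ,
      Filter.Tendsto (fun s => schur s (P.bondCurrent N b) J) (nhdsWithin (0 : ℝ) (Set.Ioi 0)) (nhds ρ) →
      Filter.Tendsto (fun s => lap s (P.bondCurrent N b) J) (nhdsWithin (0 : ℝ) (Set.Ioi 0)) (nhds ℓ) →
      ℓ - δ ≤ ρ) →
    Summit.AtomisticToContinuum.FouriersLaw.Theses.HonestZwanzig.PositiveMemory := by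
  intro hRow hCLB hBBF ω₂ lam β γ hω hl hβ hγ T hT
  -- the Green–Kubo floor `c·((N−1)T²) ≤ ∫₀^∞corr_N(J,J)` for `N ≥ N₁`
  obtain ⟨c, hc, N₁, hGK⟩ := stub_greenKuboFloor hCLB ω₂ lam β γ hω hl hβ hγ T hT
  refine ⟨c * T ^ 2 / 2, by positivity, ?_⟩
  -- the bulk backflow floor at `δ = cT²/2`
  obtain ⟨R₀, hR₀⟩ := hBBF ω₂ lam β γ hω hl hβ hγ T hT (c * T ^ 2 / 2) (by positivity)
  refine ⟨max R₀ N₁, fun N hN => ?_⟩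
  intro P X μ corr lap e G schur J b hRb hbN ρ hρ
  have hm₁ : R₀ ≤ max R₀ N₁ := le_max_left _ _
  have hm₂ : N₁ ≤ max R₀ N₁ := le_max_right _ _
  have hb : b.val + 1 < N := by omega
  have hN₁ : N₁ ≤ N := by omega
  have hR₀b : R₀ ≤ b.val := by omega
  have hbN₀ : b.val + 2 + R₀ ≤ N := by omega
  -- Kirchhoff flatness: the unprojected limit on the genuine bond `b` is `∫corr(J,J)/(N−1)`
  have hℓ : Filter.Tendsto (fun s => lap s (P.bondCurrent N b) J) (nhdsWithin (0 : ℝ) (Set.Ioi 0))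
      (nhds ((∫ t in Set.Ioi (0 : ℝ), corr J J t) / ((N : ℝ) - 1))) :=
    hRow ω₂ lam β γ hω hl hβ hγ T hT N hN b hb
  -- backflow floor: `ℓ − cT²/2 ≤ ρ`
  have hfloor : (∫ t in Set.Ioi (0 : ℝ), corr J J t) / ((N : ℝ) - 1) - c * T ^ 2 / 2 ≤ ρ :=
    hR₀ N hN b hR₀b hbN₀ ρ _ hρ hℓ
  -- Green–Kubo floor: `cT² ≤ ℓ`
  have hGKN : c * (((N : ℝ) - 1) * T ^ 2) ≤ ∫ t in Set.Ioi (0 : ℝ), corr J J t := hGK N hN₁ hN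
  have hpos : (0 : ℝ) < (N : ℝ) - 1 := by
    have h2 : (2 : ℝ) ≤ N := by exact_mod_cast hN
    linarith
  have hcT : c * T ^ 2 ≤ (∫ t in Set.Ioi (0 : ℝ), corr J J t) / ((N : ℝ) - 1) := by
    rw [le_div_iff₀ hpos]
    calc c * T ^ 2 * ((N : ℝ) - 1) = c * (((N : ℝ) - 1) * T ^ 2) := by ring
      _ ≤ _ := hGKN
  linarith

end Summit.AtomisticToContinuum.FouriersLaw.Theorems.HonestZwanzig.PositiveMemory

end
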